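import Mathlib.GroupTheory.SpecificGroups.Dihedral
import Mathlib.Tactic.Linarith
import Mathlib.Tactic.LinearCombination
import Mathlib.Tactic.Ring
import Mathlib.Tactic.Positivity
import Literature.Combinatorics.Additive.TripleProductProperty
import Summits.MatrixMultiplication.OmegaCensus.DihedralTPPFamilyAllN
import HarnessLib

/-!
# Upper half of the dihedral law: `3·|S||T||U| ≤ 8n` for every TPP triple of `D_{2n}`

ω-census, family (b3) (single TPP triples in small groups).  Framing: lottery ticket; floor = certified
bounds/negative ranges.

**Theorem (`tpp_volume_le_dihedral`).** For every `n ≥ 1` and every triple `(S, T, U)` of subsets of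
`D_{2n} = DihedralGroup n` with the triple product property, `3 |S| |T| |U| ≤ 8 n = 4 |D_{2n}|`.
Hence `β(D_{2n}) ≤ ⌊8n/3⌋`, so no dihedral group comes near the sum of the cubes of its character degrees
(`4n − 4` or `4n − 2`), uniformly in `n`; together with the kernel lower bound `β(D_{2n}) ≥ 4⌊2n/3⌋`
(`dihedral_volume_ge_law`, `DihedralTPPFamilyAllN.lean`) the TPP capacity of every dihedral group is pinned to
within `2`, and for `3 ∣ n` exactly: `β(D_{6m}) = 8m` (`dihedral_law_of_three_dvd`).  The census had confirmed the
exact value `4⌊2n/3⌋` by SAT/DRAT for `4 ≤ n ≤ 20` only.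

**Proof.** Write each set by cosets of the rotation subgroup: `X = r(X₀) ⊔ sr(X₁)` with `X₀, X₁ ⊆ ZMod n`
(`univ.filter (r · ∈ X)`, `univ.filter (sr · ∈ X)`).  Reading the TPP relation `s s'⁻¹ (t t'⁻¹) (u u'⁻¹) = 1` on suitable coset
patterns gives, in `ZMod n`:
* (injectivity, `sum_injOn`) for each of the 8 patterns `(i,j,k)` the map `(a,b,c) ↦ a+b+c` is injective on
  `S_i × T_j × U_k`, so the sumset `Σ_{ijk}` has exactly `|S_i||T_j||U_k|` elements;
* (disjointness, `disjoint_sumset₁/₂/₃`) the three sumsets `Σ_{100}, Σ_{010}, Σ_{001}` are pairwise disjoint, and so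
  are `Σ_{011}, Σ_{101}, Σ_{110}` (a common element would be a TPP relation identifying a rotation with a
  reflection).
Hence with `A₀ = s₀t₀u₀`, `A₁ = s₁t₀u₀+s₀t₁u₀+s₀t₀u₁`, `A₂ = s₀t₁u₁+s₁t₀u₁+s₁t₁u₀`, `A₃ = s₁t₁u₁` all four are
`≤ n` (counting inside `ZMod n`), while `|S||T||U| = A₀+A₁+A₂+A₃`.  The elementary-symmetric structure gives
Newton's inequalities `A₁² ≥ 3A₀A₂`, `A₂² ≥ 3A₁A₃`, and then `3(A₀+A₁+A₂+A₃) ≤ 8·max Aᵢ` (`core_rat`: if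
`A₂ ≤ A₁` then `3A₃ ≤ A₂` and `n(5n − 3A₀ − 4A₂) = (n² − 3A₀A₂) + (n − A₂)(4n − 3A₀) ≥ 0`).  Equality in the
real relaxation forces `s₀=s₁, t₀=t₁, u₀=u₁`, `3s₀t₀u₀ = n` — the shape of the extremal family `({1,s},{1,sr},U)`.

This is new mathematics of the cell (not a published statement): it lives under `Summits/`, not `Literature/`.
-/

namespace Summit.MatrixMultiplication.OmegaCensus

open Literature.Combinatorics.Additive Finset DihedralGroup

/-! ## The arithmetic core -/

/-- Core inequality over `ℚ`: if `Aᵢ ≤ n` (`i = 0..3`, with `A₀, A₁, A₂ ≥ 0`) satisfy Newton's inequalities `3A₀A₂ ≤ A₁²` and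
`3A₁A₃ ≤ A₂²`, then `3(A₀+A₁+A₂+A₃) ≤ 8n` (sharp at `(n/3, n, n, n/3)`). [folklore] -/
theorem core_rat (n A₀ A₁ A₂ A₃ : ℚ) (hA₀ : 0 ≤ A₀) (hA₁ : 0 ≤ A₁) (hA₂ : 0 ≤ A₂)
    (h₀ : A₀ ≤ n) (h₁ : A₁ ≤ n) (h₂ : A₂ ≤ n) (h₃ : A₃ ≤ n)
    (hN₁ : 3 * A₀ * A₂ ≤ A₁ ^ 2) (hN₂ : 3 * A₁ * A₃ ≤ A₂ ^ 2) :
    3 * (A₀ + A₁ + A₂ + A₃) ≤ 8 * n := by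
  rcases le_total A₂ A₁ with h | h
  · -- `A₂ ≤ A₁`
    rcases eq_or_lt_of_le hA₁ with h1 | h1
    · -- `A₁ = 0`, hence `A₂ = 0`
      have hA2z : A₂ = 0 := le_antisymm (h1 ▸ h) hA₂
      subst hA2z
      nlinarith
    · have hn : 0 < n := lt_of_lt_of_le h1 h₁
      -- `3 A₃ ≤ A₂`
      have h33 : A₁ * (3 * A₃) ≤ A₁ * A₂ := by nlinarith [mul_le_mul_of_nonneg_left h hA₂]
      have hA3 : 3 * A₃ ≤ A₂ := le_of_mul_le_mul_left h33 h1
      -- `3 A₀ + 4 A₂ ≤ 5 n` from `n (5n - 3A₀ - 4A₂) = (n² - 3 A₀ A₂) + (n - A₂)(4n - 3A₀)`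
      have hsq : 3 * A₀ * A₂ ≤ n ^ 2 := by nlinarith
      have h54 : n * (3 * A₀ + 4 * A₂) ≤ n * (5 * n) := by
        nlinarith [mul_nonneg (sub_nonneg.2 h₂) (by linarith : (0:ℚ) ≤ 4 * n - 3 * A₀)]
      have h54' : 3 * A₀ + 4 * A₂ ≤ 5 * n := le_of_mul_le_mul_left h54 hn
      linarith
  · -- `A₁ ≤ A₂`: the mirror image (`A₀ ↔ A₃`, `A₁ ↔ A₂`)
    rcases eq_or_lt_of_le hA₂ with h2 | h2
    · have hA1z : A₁ = 0 := le_antisymm (h2 ▸ h) hA₁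
      subst hA1z
      nlinarith
    · have hn : 0 < n := lt_of_lt_of_le h2 h₂
      have h00 : A₂ * (3 * A₀) ≤ A₂ * A₁ := by nlinarith [mul_le_mul_of_nonneg_left h hA₁]
      have hA0 : 3 * A₀ ≤ A₁ := le_of_mul_le_mul_left h00 h2
      have hsq : 3 * A₁ * A₃ ≤ n ^ 2 := by nlinarith
      have h54 : n * (3 * A₃ + 4 * A₁) ≤ n * (5 * n) := by
        nlinarith [mul_nonneg (sub_nonneg.2 h₁) (by linarith : (0:ℚ) ≤ 4 * n - 3 * A₃)]
      have h54' : 3 * A₃ + 4 * A₁ ≤ 5 * n := le_of_mul_le_mul_left h54 hn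
      linarith

/-- Core inequality over `ℕ` in the six coset-part sizes: if `s₀t₀u₀ ≤ n`, `s₁t₁u₁ ≤ n`,
`s₁t₀u₀+s₀t₁u₀+s₀t₀u₁ ≤ n` and `s₀t₁u₁+s₁t₀u₁+s₁t₁u₀ ≤ n` then `3(s₀+s₁)(t₀+t₁)(u₀+u₁) ≤ 8n`
(Newton's inequalities for the elementary symmetric functions of `s₁/s₀, t₁/t₀, u₁/u₀`, then `core_rat`). [folklore] -/
theorem core_nat (n s₀ s₁ t₀ t₁ u₀ u₁ : ℕ) (h₀ : s₀ * t₀ * u₀ ≤ n) (h₃ : s₁ * t₁ * u₁ ≤ n)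
    (h₁ : s₁ * t₀ * u₀ + s₀ * t₁ * u₀ + s₀ * t₀ * u₁ ≤ n)
    (h₂ : s₀ * t₁ * u₁ + s₁ * t₀ * u₁ + s₁ * t₁ * u₀ ≤ n) :
    3 * ((s₀ + s₁) * (t₀ + t₁) * (u₀ + u₁)) ≤ 8 * n := by
  have main : (3 : ℚ) * ((s₀ + s₁) * (t₀ + t₁) * (u₀ + u₁)) ≤ 8 * n := by
    set A₀ : ℚ := s₀ * t₀ * u₀ with hA₀
    set A₃ : ℚ := s₁ * t₁ * u₁ with hA₃
    set X : ℚ := s₁ * t₀ * u₀ with hX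
    set Y : ℚ := s₀ * t₁ * u₀ with hY
    set Z : ℚ := s₀ * t₀ * u₁ with hZ
    set X' : ℚ := s₀ * t₁ * u₁ with hX'
    set Y' : ℚ := s₁ * t₀ * u₁ with hY'
    set Z' : ℚ := s₁ * t₁ * u₀ with hZ'
    have q₀ : A₀ ≤ n := by rw [hA₀]; exact_mod_cast h₀
    have q₃ : A₃ ≤ n := by rw [hA₃]; exact_mod_cast h₃
    have q₁ : X + Y + Z ≤ n := by rw [hX, hY, hZ]; exact_mod_cast h₁
    have q₂ : X' + Y' + Z' ≤ n := by rw [hX', hY', hZ']; exact_mod_cast h₂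
    have e₁ : A₀ * (X' + Y' + Z') = X * Y + Y * Z + Z * X := by
      simp only [hA₀, hX, hY, hZ, hX', hY', hZ']; ring
    have e₂ : (X + Y + Z) * A₃ = X' * Y' + Y' * Z' + Z' * X' := by
      simp only [hA₃, hX, hY, hZ, hX', hY', hZ']; ring
    have eV : ((s₀ : ℚ) + s₁) * (t₀ + t₁) * (u₀ + u₁) = A₀ + (X + Y + Z) + (X' + Y' + Z') + A₃ := by
      simp only [hA₀, hA₃, hX, hY, hZ, hX', hY', hZ']; ring
    have hN₁ : 3 * A₀ * (X' + Y' + Z') ≤ (X + Y + Z) ^ 2 := by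
      nlinarith [e₁, sq_nonneg (X - Y), sq_nonneg (Y - Z), sq_nonneg (Z - X)]
    have hN₂ : 3 * (X + Y + Z) * A₃ ≤ (X' + Y' + Z') ^ 2 := by
      nlinarith [e₂, sq_nonneg (X' - Y'), sq_nonneg (Y' - Z'), sq_nonneg (Z' - X')]
    rw [eV]
    exact core_rat n A₀ (X + Y + Z) (X' + Y' + Z') A₃ (by positivity) (by positivity) (by positivity)
      q₀ q₁ q₂ q₃ hN₁ hN₂
  exact_mod_cast main

/-! ## Coset coordinates in `D_{2n}`

No auxiliary definitions are introduced: the coset-`b` element of `D_{2n}` with `ZMod n`-coordinate `i` is written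
`cond b (sr i) (r i)` (`r i` for `b = false`, `sr i` for `b = true`), a "coset part" of `X ⊆ D_{2n}` is any
`A ⊆ ZMod n` with `∀ a ∈ A, cond b (sr a) (r a) ∈ X` (instantiated at the end with the full parts
`univ.filter (r · ∈ X)`, `univ.filter (sr · ∈ X)`), and the sumset of `A, B, C ⊆ ZMod n` is the image of
`A ×ˢ B ×ˢ C` under `p ↦ p.1 + p.2.1 + p.2.2`. -/

variable {n : ℕ}

/-- `|X| = |{i : r i ∈ X}| + |{i : sr i ∈ X}|`. [folklore] -/
theorem card_eq_parts [NeZero n] (X : Finset (DihedralGroup n)) :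
    X.card = (univ.filter fun i : ZMod n => r i ∈ X).card + (univ.filter fun i : ZMod n => sr i ∈ X).card := by
  have hr : Function.Injective (r : ZMod n → DihedralGroup n) := fun a b h => by cases h; rfl
  have hsr : Function.Injective (sr : ZMod n → DihedralGroup n) := fun a b h => by cases h; rfl
  have hX : X = (univ.filter fun i : ZMod n => r i ∈ X).map ⟨r, hr⟩ ∪
      (univ.filter fun i : ZMod n => sr i ∈ X).map ⟨sr, hsr⟩ := by
    ext g
    simp only [mem_union, mem_map, mem_filter, mem_univ, true_and, Function.Embedding.coeFn_mk]
    constructor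
    · intro hg
      cases g with
      | r i => exact Or.inl ⟨i, hg, rfl⟩
      | sr i => exact Or.inr ⟨i, hg, rfl⟩
    · rintro (⟨i, hi, rfl⟩ | ⟨i, hi, rfl⟩) <;> exact hi
  have hdisj : Disjoint ((univ.filter fun i : ZMod n => r i ∈ X).map ⟨r, hr⟩)
      ((univ.filter fun i : ZMod n => sr i ∈ X).map ⟨sr, hsr⟩) := by
    rw [disjoint_left]
    intro g hg hg'
    simp only [mem_map, Function.Embedding.coeFn_mk] at hg hg'
    obtain ⟨i, -, rfl⟩ := hg
    obtain ⟨j, -, h⟩ := hg'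
    cases h
  conv_lhs => rw [hX]
  rw [card_union_of_disjoint hdisj, card_map, card_map]

/-- The pair `(cond b (sr a') (r a), cond b (sr a) (r a'))` of coset-`b` elements has right quotient the ROTATION
`r (a − a')` for both values of `b` (`r a (r a')⁻¹ = r(a−a')`, `sr a' (sr a)⁻¹ = r(a−a')`). [folklore] -/
theorem cond_mul_cond_inv (b : Bool) (a a' : ZMod n) :
    cond b (sr a') (r a) * (cond b (sr a) (r a'))⁻¹ = (r (a - a') : DihedralGroup n) := by
  cases b
  · simp only [Bool.cond_false, inv_r, r_mul_r]; congr 1; ring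
  · simp only [Bool.cond_true, inv_sr, sr_mul_sr]

/-- Membership of the first element of that pair. [folklore] -/
theorem cond_mem_fst {X : Finset (DihedralGroup n)} {b : Bool} {a a' : ZMod n}
    (ha : cond b (sr a) (r a) ∈ X) (ha' : cond b (sr a') (r a') ∈ X) : cond b (sr a') (r a) ∈ X := by
  cases b
  · simpa only [Bool.cond_false] using ha
  · simpa only [Bool.cond_true] using ha'

/-- Membership of the second element of that pair. [folklore] -/
theorem cond_mem_snd {X : Finset (DihedralGroup n)} {b : Bool} {a a' : ZMod n}
    (ha : cond b (sr a) (r a) ∈ X) (ha' : cond b (sr a') (r a') ∈ X) : cond b (sr a) (r a') ∈ X := by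
  cases b
  · simpa only [Bool.cond_false] using ha'
  · simpa only [Bool.cond_true] using ha

/-- Equality of the two elements of the pair forces `a = a'`. [folklore] -/
theorem eq_of_cond_eq_cond {b : Bool} {a a' : ZMod n}
    (h : cond b (sr a') (r a) = (cond b (sr a) (r a') : DihedralGroup n)) : a = a' := by
  cases b
  · simp only [Bool.cond_false] at h; cases h; rfl
  · simp only [Bool.cond_true] at h; cases h; rfl


/-- Unpacking membership in a sumset `{a+b+c}`. [folklore] -/
theorem mem_sumset₃ {M : Type*} [AddCommMonoid M] [DecidableEq M] {A B C : Finset M} {x : M} :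
    x ∈ (A ×ˢ B ×ˢ C).image (fun p : M × M × M => p.1 + p.2.1 + p.2.2) ↔
      ∃ a ∈ A, ∃ b ∈ B, ∃ c ∈ C, a + b + c = x := by
  simp only [mem_image, mem_product, Prod.exists]
  constructor
  · rintro ⟨a, b, c, ⟨ha, hb, hc⟩, rfl⟩; exact ⟨a, ha, b, hb, c, hc, rfl⟩
  · rintro ⟨a, ha, b, hb, c, hc, rfl⟩; exact ⟨a, b, c, ⟨ha, hb, hc⟩, rfl⟩

/-! ## What the TPP says about coset sumsets -/

variable {S T U : Finset (DihedralGroup n)}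

/-- **Injectivity.** For a TPP triple, coset pattern `(i,j,k)` and parts `A ⊆ S_i`, `B ⊆ T_j`, `C ⊆ U_k` (read in
`ZMod n`), `(a,b,c) ↦ a+b+c` is injective on `A × B × C` (the TPP relation with the rotation
`r((a−a')+(b−b')+(c−c')) = 1`). [folklore] -/
theorem sum_injOn (h : TripleProductProperty S T U) (i j k : Bool) {A B C : Finset (ZMod n)}
    (hA : ∀ a ∈ A, cond i (sr a) (r a) ∈ S) (hB : ∀ b ∈ B, cond j (sr b) (r b) ∈ T)
    (hC : ∀ c ∈ C, cond k (sr c) (r c) ∈ U) :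
    Set.InjOn (fun p : ZMod n × ZMod n × ZMod n => p.1 + p.2.1 + p.2.2) ↑(A ×ˢ B ×ˢ C) := by
  rintro ⟨a, b, c⟩ hp ⟨a', b', c'⟩ hp' heq
  simp only [coe_product, Set.mem_prod, mem_coe] at hp hp'
  simp only at heq
  have key : cond i (sr a') (r a) * (cond i (sr a) (r a'))⁻¹ *
      (cond j (sr b') (r b) * (cond j (sr b) (r b'))⁻¹) *
      (cond k (sr c') (r c) * (cond k (sr c) (r c'))⁻¹) = (1 : DihedralGroup n) := by
    rw [cond_mul_cond_inv, cond_mul_cond_inv, cond_mul_cond_inv, r_mul_r, r_mul_r, one_def]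
    congr 1
    linear_combination heq
  obtain ⟨h1, h2, h3⟩ := h _ (cond_mem_fst (hA a hp.1) (hA a' hp'.1)) _ (cond_mem_snd (hA a hp.1) (hA a' hp'.1))
    _ (cond_mem_fst (hB b hp.2.1) (hB b' hp'.2.1)) _ (cond_mem_snd (hB b hp.2.1) (hB b' hp'.2.1))
    _ (cond_mem_fst (hC c hp.2.2) (hC c' hp'.2.2)) _ (cond_mem_snd (hC c hp.2.2) (hC c' hp'.2.2)) key
  have ea := eq_of_cond_eq_cond h1
  have eb := eq_of_cond_eq_cond h2
  have ec := eq_of_cond_eq_cond h3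
  subst ea eb ec
  rfl

/-- `|A + B + C| = |A| |B| |C|` for coset parts of a TPP triple. [folklore] -/
theorem card_sumset (h : TripleProductProperty S T U) (i j k : Bool) {A B C : Finset (ZMod n)}
    (hA : ∀ a ∈ A, cond i (sr a) (r a) ∈ S) (hB : ∀ b ∈ B, cond j (sr b) (r b) ∈ T)
    (hC : ∀ c ∈ C, cond k (sr c) (r c) ∈ U) :
    ((A ×ˢ B ×ˢ C).image fun p : ZMod n × ZMod n × ZMod n => p.1 + p.2.1 + p.2.2).card =
      A.card * B.card * C.card := by
  rw [card_image_of_injOn (sum_injOn h i j k hA hB hC), card_product, card_product, mul_assoc]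

/-- **Disjointness 1** (patterns `(1,0,k)` / `(0,1,k)`): `(S₁ + T₀ + U_k) ∩ (S₀ + T₁ + U_k) = ∅`; a common element
would give the TPP relation `sr a (r a')⁻¹ · (r b (sr b')⁻¹) · (u u'⁻¹) = 1`, forcing `sr a = r a'`. [folklore] -/
theorem disjoint_sumset₁ (h : TripleProductProperty S T U) (k : Bool) {A B C A' B' : Finset (ZMod n)}
    (hA : ∀ a ∈ A, sr a ∈ S) (hB : ∀ b ∈ B, r b ∈ T) (hC : ∀ c ∈ C, cond k (sr c) (r c) ∈ U)
    (hA' : ∀ a ∈ A', r a ∈ S) (hB' : ∀ b ∈ B', sr b ∈ T) :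
    Disjoint ((A ×ˢ B ×ˢ C).image fun p : ZMod n × ZMod n × ZMod n => p.1 + p.2.1 + p.2.2)
      ((A' ×ˢ B' ×ˢ C).image fun p : ZMod n × ZMod n × ZMod n => p.1 + p.2.1 + p.2.2) := by
  rw [disjoint_left]
  intro x hx hx'
  rw [mem_sumset₃] at hx hx'
  obtain ⟨a, ha, b, hb, c, hc, rfl⟩ := hx
  obtain ⟨a', ha', b', hb', c', hc', heq⟩ := hx'
  have key : sr a * (r a')⁻¹ * (r b * (sr b')⁻¹) *
      (cond k (sr c) (r c') * (cond k (sr c') (r c))⁻¹) = 1 := by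
    rw [cond_mul_cond_inv, inv_r, inv_sr, sr_mul_r, r_mul_sr, sr_mul_sr, r_mul_r, one_def]
    congr 1
    linear_combination heq
  obtain ⟨h1, -, -⟩ := h _ (hA a ha) _ (hA' a' ha') _ (hB b hb) _ (hB' b' hb')
    _ (cond_mem_fst (hC c' hc') (hC c hc)) _ (cond_mem_snd (hC c' hc') (hC c hc)) key
  cases h1

/-- **Disjointness 2** (patterns `(i,1,0)` / `(i,0,1)`): `(S_i + T₁ + U₀) ∩ (S_i + T₀ + U₁) = ∅` (the relation
would force `sr b = r b'`). [folklore] -/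
theorem disjoint_sumset₂ (h : TripleProductProperty S T U) (i : Bool) {A B C A' B' C' : Finset (ZMod n)}
    (hA : ∀ a ∈ A, cond i (sr a) (r a) ∈ S) (hB : ∀ b ∈ B, sr b ∈ T) (hC : ∀ c ∈ C, r c ∈ U)
    (hA' : ∀ a ∈ A', cond i (sr a) (r a) ∈ S) (hB' : ∀ b ∈ B', r b ∈ T) (hC' : ∀ c ∈ C', sr c ∈ U) :
    Disjoint ((A ×ˢ B ×ˢ C).image fun p : ZMod n × ZMod n × ZMod n => p.1 + p.2.1 + p.2.2)
      ((A' ×ˢ B' ×ˢ C').image fun p : ZMod n × ZMod n × ZMod n => p.1 + p.2.1 + p.2.2) := by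
  rw [disjoint_left]
  intro x hx hx'
  rw [mem_sumset₃] at hx hx'
  obtain ⟨a, ha, b, hb, c, hc, rfl⟩ := hx
  obtain ⟨a', ha', b', hb', c', hc', heq⟩ := hx'
  have key : cond i (sr a) (r a') * (cond i (sr a') (r a))⁻¹ * (sr b * (r b')⁻¹) * (r c * (sr c')⁻¹) =
      (1 : DihedralGroup n) := by
    rw [cond_mul_cond_inv, inv_r, inv_sr, sr_mul_r, r_mul_sr, r_mul_sr, sr_mul_sr, one_def]
    congr 1
    linear_combination heq
  obtain ⟨-, h2, -⟩ := h _ (cond_mem_fst (hA' a' ha') (hA a ha)) _ (cond_mem_snd (hA' a' ha') (hA a ha))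
    _ (hB b hb) _ (hB' b' hb') _ (hC c hc) _ (hC' c' hc') key
  cases h2

/-- **Disjointness 3** (patterns `(0,j,1)` / `(1,j,0)`): `(S₀ + T_j + U₁) ∩ (S₁ + T_j + U₀) = ∅` (the relation
would force `r a = sr a'`). [folklore] -/
theorem disjoint_sumset₃ (h : TripleProductProperty S T U) (j : Bool) {A B C A' C' : Finset (ZMod n)}
    (hA : ∀ a ∈ A, r a ∈ S) (hB : ∀ b ∈ B, cond j (sr b) (r b) ∈ T) (hC : ∀ c ∈ C, sr c ∈ U)
    (hA' : ∀ a ∈ A', sr a ∈ S) (hC' : ∀ c ∈ C', r c ∈ U) :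
    Disjoint ((A ×ˢ B ×ˢ C).image fun p : ZMod n × ZMod n × ZMod n => p.1 + p.2.1 + p.2.2)
      ((A' ×ˢ B ×ˢ C').image fun p : ZMod n × ZMod n × ZMod n => p.1 + p.2.1 + p.2.2) := by
  rw [disjoint_left]
  intro x hx hx'
  rw [mem_sumset₃] at hx hx'
  obtain ⟨a, ha, b, hb, c, hc, rfl⟩ := hx
  obtain ⟨a', ha', b', hb', c', hc', heq⟩ := hx'
  have key : r a * (sr a')⁻¹ * (cond j (sr b) (r b') * (cond j (sr b') (r b))⁻¹) * (sr c * (r c')⁻¹) = 1 := by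
    rw [cond_mul_cond_inv, inv_r, inv_sr, r_mul_sr, sr_mul_r, sr_mul_r, sr_mul_sr, one_def]
    congr 1
    linear_combination -heq
  obtain ⟨h1, -, -⟩ := h _ (hA a ha) _ (hA' a' ha') _ (cond_mem_fst (hB b' hb') (hB b hb))
    _ (cond_mem_snd (hB b' hb') (hB b hb)) _ (hC c hc) _ (hC' c' hc') key
  cases h1

/-! ## The theorems -/

variable [NeZero n]

/-- **Upper half of the dihedral law.** For every TPP triple `(S, T, U)` in `D_{2n} = DihedralGroup n`:
`3 |S| |T| |U| ≤ 8 n = 4 |D_{2n}|`.  In particular `β(D_{2n}) ≤ ⌊(4/3)|D_{2n}|⌋`, uniformly below the sum of the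
cubes of the character degrees (`4n−4` / `4n−2`) for all `n ≥ 3`. [folklore] -/
theorem tpp_volume_le_dihedral (h : TripleProductProperty S T U) :
    3 * (S.card * T.card * U.card) ≤ 8 * n := by
  -- the six coset parts
  set S₀ : Finset (ZMod n) := univ.filter fun i => r i ∈ S with hS₀
  set S₁ : Finset (ZMod n) := univ.filter fun i => sr i ∈ S with hS₁
  set T₀ : Finset (ZMod n) := univ.filter fun i => r i ∈ T with hT₀
  set T₁ : Finset (ZMod n) := univ.filter fun i => sr i ∈ T with hT₁
  set U₀ : Finset (ZMod n) := univ.filter fun i => r i ∈ U with hU₀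
  set U₁ : Finset (ZMod n) := univ.filter fun i => sr i ∈ U with hU₁
  have mS₀ : ∀ a ∈ S₀, cond false (sr a) (r a) ∈ S := fun a ha => by simpa [hS₀] using ha
  have mS₁ : ∀ a ∈ S₁, cond true (sr a) (r a) ∈ S := fun a ha => by simpa [hS₁] using ha
  have mT₀ : ∀ a ∈ T₀, cond false (sr a) (r a) ∈ T := fun a ha => by simpa [hT₀] using ha
  have mT₁ : ∀ a ∈ T₁, cond true (sr a) (r a) ∈ T := fun a ha => by simpa [hT₁] using ha
  have mU₀ : ∀ a ∈ U₀, cond false (sr a) (r a) ∈ U := fun a ha => by simpa [hU₀] using ha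
  have mU₁ : ∀ a ∈ U₁, cond true (sr a) (r a) ∈ U := fun a ha => by simpa [hU₁] using ha
  have hn : ∀ A : Finset (ZMod n), A.card ≤ n := fun A => by
    simpa only [ZMod.card] using card_le_univ A
  -- the four counting constraints
  have h₀ : S₀.card * T₀.card * U₀.card ≤ n := by
    rw [← card_sumset h false false false mS₀ mT₀ mU₀]; exact hn _
  have h₃ : S₁.card * T₁.card * U₁.card ≤ n := by
    rw [← card_sumset h true true true mS₁ mT₁ mU₁]; exact hn _
  have h₁ : S₁.card * T₀.card * U₀.card + S₀.card * T₁.card * U₀.card + S₀.card * T₀.card * U₁.card ≤ n := by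
    rw [← card_sumset h true false false mS₁ mT₀ mU₀, ← card_sumset h false true false mS₀ mT₁ mU₀,
      ← card_sumset h false false true mS₀ mT₀ mU₁,
      ← card_union_of_disjoint (disjoint_sumset₁ h false mS₁ mT₀ mU₀ mS₀ mT₁),
      ← card_union_of_disjoint (disjoint_union_left.2
        ⟨(disjoint_sumset₃ h false mS₀ mT₀ mU₁ mS₁ mU₀).symm, disjoint_sumset₂ h false mS₀ mT₁ mU₀ mS₀ mT₀ mU₁⟩)]
    exact hn _
  have h₂ : S₀.card * T₁.card * U₁.card + S₁.card * T₀.card * U₁.card + S₁.card * T₁.card * U₀.card ≤ n := by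
    rw [← card_sumset h false true true mS₀ mT₁ mU₁, ← card_sumset h true false true mS₁ mT₀ mU₁,
      ← card_sumset h true true false mS₁ mT₁ mU₀,
      ← card_union_of_disjoint (disjoint_sumset₁ h true mS₁ mT₀ mU₁ mS₀ mT₁).symm,
      ← card_union_of_disjoint (disjoint_union_left.2
        ⟨disjoint_sumset₃ h true mS₀ mT₁ mU₁ mS₁ mU₀, (disjoint_sumset₂ h true mS₁ mT₁ mU₀ mS₁ mT₀ mU₁).symm⟩)]
    exact hn _
  rw [card_eq_parts S, card_eq_parts T, card_eq_parts U]
  exact core_nat n _ _ _ _ _ _ h₀ h₃ h₁ h₂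

/-- The same bound against the group order: `3 |S||T||U| ≤ 4 |D_{2n}|`. [folklore] -/
theorem tpp_volume_le_dihedral_card (h : TripleProductProperty S T U) :
    3 * (S.card * T.card * U.card) ≤ 4 * Fintype.card (DihedralGroup n) := by
  rw [DihedralGroup.card]
  have := tpp_volume_le_dihedral h
  omega

/-- For `3 ∣ n` the counting bound is the exact law value: every TPP triple of `D_{2n}` has volume
`≤ 4⌊2n/3⌋ = 8n/3`. [folklore] -/
theorem tpp_volume_le_law_of_three_dvd (h3 : 3 ∣ n) (h : TripleProductProperty S T U) :
    S.card * T.card * U.card ≤ 4 * (2 * n / 3) := by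
  have := tpp_volume_le_dihedral h
  obtain ⟨m, rfl⟩ := h3
  omega

omit [NeZero n] in
/-- **The dihedral law for `3 ∣ n`, both halves: `β(D_{6m}) = 8m`.**  Every TPP triple of
`DihedralGroup (3m)` has `|S||T||U| ≤ 8m`, and the uniform family of `DihedralTPPFamilyAllN.lean` attains `8m`.
[folklore] -/
theorem dihedral_law_of_three_dvd (m : ℕ) [NeZero m] :
    (∀ S T U : Finset (DihedralGroup (3 * m)), TripleProductProperty S T U → S.card * T.card * U.card ≤ 8 * m) ∧
    ∃ S T U : Finset (DihedralGroup (3 * m)), TripleProductProperty S T U ∧ S.card * T.card * U.card = 8 * m := by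
  refine ⟨fun S T U h => ?_, ?_⟩
  · have := tpp_volume_le_dihedral h
    omega
  · have h3 : 3 ≤ 3 * m := Nat.le_mul_of_pos_right 3 (Nat.pos_of_ne_zero (NeZero.ne m))
    obtain ⟨S, T, U, h, -, -, -, hvol⟩ := dihedral_volume_ge_law (3 * m) h3
    refine ⟨S, T, U, h, ?_⟩
    rw [hvol]
    omega

/-- **Two-sided dihedral law for all `n ≥ 3`:** `4⌊2n/3⌋ ≤ β(D_{2n}) ≤ ⌊8n/3⌋` — the lower witness of
`dihedral_volume_ge_law` and the upper bound `tpp_volume_le_dihedral`, a window of width at most `2`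
(`0` when `3 ∣ n`). [folklore] -/
theorem dihedral_law_window (hn : 3 ≤ n) :
    (∃ S T U : Finset (DihedralGroup n), TripleProductProperty S T U ∧ S.card * T.card * U.card = 4 * (2 * n / 3)) ∧
    ∀ S T U : Finset (DihedralGroup n), TripleProductProperty S T U → S.card * T.card * U.card ≤ 8 * n / 3 := by
  refine ⟨?_, fun S T U h => ?_⟩
  · obtain ⟨S, T, U, h, -, -, -, hvol⟩ := dihedral_volume_ge_law n hn
    exact ⟨S, T, U, h, hvol⟩
  · have := tpp_volume_le_dihedral h
    omega

end Summit.MatrixMultiplication.OmegaCensus
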